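import Literature.AlgebraicGeometry.Motives.HodgeStructureLefschetzGroupCenterByType
import Literature.AlgebraicGeometry.Motives.HodgeStructureStableSubHodgeStructuresIsotypicComponents
import Literature.NumberTheory.NumberFields.CMFieldUnitaryGroup
import HarnessLib

/-!
# THE CENTRE OF `S(A)(ℚ)` IS MILNE'S `S₀(A)(ℚ) = {γ ∈ C₀ | γ†γ = 1}`, AND ITS SIZE BY ALBERT TYPE: FINITE OF ORDER EXACTLY
# `2^t` (`t` = the number of simple factors of `End⁰`) when the Rosati involution is of the FIRST KIND on the centre
# (types I–III: `S(A)` semisimple), INFINITE and `≅ U_K(ℚ)` for a CM centre `K` (type IV: `S(A)` not semisimple)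
# (Milne 1999 §1 p. 645, §2 Summary p. 652; Moonen–Zarhin 1998 §1 Lemma (1))

[topic AlgebraicGeometry/Motives]

Layer `Literature/AlgebraicGeometry/Motives`, lane `lit-hodgefound` (Track 2 foundations library; prover seat
`lit-hodgefound-p02`, generation 54, self-proposed row g54-#8). THEOREMS ONLY: no definition, no named fact (net debt `0`),
no instance, no notation.  Sequel of g54-#4 (`Motives/HodgeStructureLefschetzGroupCenter`: `γ ∈ S(H)(ℚ)` is central iff
`↑γ ∈ Z(E_φ)`) and g54-#5 (`Motives/HodgeStructureLefschetzGroupCenterByType`: first kind ⟹ central elements are involutions;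
CM centre ⟹ central elements are the norm-one elements).  Milne (p. 645 L1–L14) defines, for an abelian variety over `𝔽`,
the group `S₀(A)(R) = {γ ∈ C₀(A) ⊗_ℚ R | γ†γ = 1}` cut out of the centre `C₀(A)` of `End⁰(A)` («a product of fields, each of
which is either a CM-field or `ℚ`») and proves `S₀(A) ≅` the centre part of `S(A)` (Prop. 1.7); the Summary table (p. 652)
records that `S(A)` is SEMISIMPLE for types I, II, III and NOT semisimple for type IV; Moonen–Zarhin's Lemma (1) says the same
for the divisor Lefschetz group: the centre «is the group `U_{K_B}` […] For `X` of type 4 […] a connected torus […]; in all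
other cases it is finite».  Here, for a polarized `ℚ`-Hodge structure `(H, ψ)` with `E_φ = End_{ℚ-HS}(V)`, `C₀ = Z(E_φ)`,
`S(H)(ℚ) = ψ.lefschetzGroup`:
(i) `γ ↦ ↑γ` is a BIJECTION from `Z(S(H)(ℚ))` onto `S₀(ℚ) = {z ∈ Z(E_φ) | z† z = 1}` (every `z ∈ Z(E_φ)` with `z† z = 1` IS a
central element of `S(H)(ℚ)`, the converse being g54-#4);
(ii) FIRST KIND (`†` trivial on `Z(E_φ)`, types I–III): `Z(S(H)(ℚ))` is FINITE, of order EXACTLY `2^t` where `t` is the number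
of canonical blocks of `H` (= minimal non-zero `E_φ`-stable sub-Hodge structures = isotypic components = simple factors of
`E_φ`, the tree's `natCard_minimal_stable_eq_card`): along `ζ : Z(E_φ) ≃+* Π_k Z(E_φ(W_k))` (the tree's
`exists_ringEquiv_subringCenter_pi`, factors FIELDS) a central `γ` has `γ² = 1` (g54-#5), so each coordinate is `±1`, and
conversely every sign vector `(±1)_k` is a `†`-fixed central unit with `z† z = z² = 1`, hence a central element by (i):
`Z(S(H)(ℚ)) ≅ μ₂^t`;
(iii) TYPE IV (isotypic with CM centre `K ≅ Z(E_φ)`): `Z(S(H)(ℚ)) ≅ U_K(ℚ) = {x ∈ K | x x̄ = 1}` as a GROUP (Mathlib's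
`unitary K`), in particular `Z(S(H)(ℚ))` is INFINITE (the tree's `IsCMField.infinite_unitary`, Hilbert 90).

## The sources, verbatim

* J. S. Milne, *Lefschetz classes on abelian varieties*, Duke Math. J. 96 (1999) 639–675 [Milne1999LefschetzClasses] (held
  `paper:doi-10-1215-s0012-7094-99-09620-5`, folios 6, 7, 14): p. 644 L22–L24 "It is a reductive group (not necessarily
  connected), and when `A` has no factor of type III it is connected"; p. 645 L1–L14 "let `C₀(A)` be the centre of the
  `ℚ`-algebra `End⁰(A)` — it is a product of fields, each of which is either a CM-field or `ℚ`. Every Rosati involution `†`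
  preserves each factor of `C₀(A)` and acts on it as complex conjugation. Define `S₀(A)` to be the algebraic group over `ℚ` such
  that, for all commutative `ℚ`-algebras `R`, `S₀(A)(R) = {γ ∈ C₀(A) ⊗_ℚ R | γ†γ = 1}`. Proposition 1.7. The action of
  `End⁰(A)` on `V(A)` induces an isomorphism `C₀(A) ⊗_ℚ ℚ_ℓ → C(A)` of `ℚ_ℓ`-algebras with involution, and hence an
  isomorphism of algebraic groups `S₀(A)_{/ℚ_ℓ} → S(A)`."; §2 Summary p. 652 (table «Type — Group — Semisimple — Connected»:
  I `Sp` Yes Yes; II `Sp` Yes Yes; III `O` Yes No; IV `GL` No Yes).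
* B. J. J. Moonen, Yu. G. Zarhin, *Weil classes on abelian varieties*, J. reine angew. Math. 496 (1998) 83–92
  [MoonenZarhin1998WeilClasses] (held `paper:arxiv-alg-geom_9612017`, chunk p0002 L121–L127): «Lemma. (1) The center of
  `G_div(X)` is the group `U_{K_B}` given by `U_{K_B}(R) = {a ∈ (K_B ⊗_ℚ R)^* ∣ a a† = 1}`. For `X` of type 4 with either
  `d ≥ 2` or `m ≥ 2` this is a connected torus of rank `e₀`; in all other cases it is finite.»
* H. Lange, *Abelian Varieties over the Complex Numbers* (2023) [Lange2023AbelianVarietiesComplex], §2.6.2 Lemma 2.6.4 and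
  Lemma 2.6.6 (first/second kind on the centre), §2.4.4 Cor. 2.4.26 (the simple factors).

Nearest tree results, BY NAME (other carriers): the abelian-variety / `ℂ`-points versions for complex abelian varieties
(`Literature/AlgebraicGeometry/HodgeTheory/DivisorLefschetzGroupCentreFinite`, `…CentreFiniteIffNoTypeIVFactor`,
`LefschetzGroupCentreInfiniteOfTypeIVFactor`: `Z(S(A)(h)(ℂ))` finite iff no factor of type IV, order `≤ 2^{[K:ℚ]}`); here the
abstract `ℚ`-Hodge-structure group `ψ.lefschetzGroup`, its `ℚ`-points, the EXACT order `2^t`, and the group isomorphism with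
`unitary K`.

## Dictionary and what is proved (namespace `Literature.AlgebraicGeometry.Motives.HodgeStructure`)

`S(H)(ℚ) = ψ.lefschetzGroup ≤ GL(V)`, `Z(E_φ) = Subalgebra.center ℚ H.endAlg` (same carrier as `Subring.center H.endAlg`),
`†` = `ψ.adjoint`, `t` = `Nat.card {S // S minimal non-zero E_φ-stable}`, `x̄ = NumberField.IsCMField.complexConj K x`.

* §1 `S₀(ℚ) = Z(S(H)(ℚ))`: **`Polarization.exists_mem_center_lefschetzGroup_coe_eq`** (every `z ∈ Z(E_φ)` with `z† z = 1` is
  `↑γ` for a central `γ ∈ S(H)(ℚ)`), **`Polarization.bijOn_coe_center_lefschetzGroup`** (`γ ↦ ↑γ` is a bijection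
  `Z(S(H)(ℚ)) → {a | a ∈ Z(E_φ), a† a = 1}`).
* §2 FIRST KIND: **`Polarization.natCard_center_lefschetzGroup_eq_two_pow_of_ringEquiv_pi`** (`C₀ ≅ K₁ × ⋯ × K_t` fields ⟹
  `#Z(S(H)(ℚ)) = 2^t`), **`Polarization.finite_center_lefschetzGroup_of_forall_adjoint_eq_self`** (`Z(S(H)(ℚ))` is finite),
  **`Polarization.natCard_center_lefschetzGroup_eq_two_pow`** (`#Z(S(H)(ℚ)) = 2^t`, `t` = the number of canonical blocks).
* §3 CM CENTRE: **`Polarization.exists_unitary_mulEquiv_center_lefschetzGroup`** (`U_K(ℚ) ≃* Z(S(H)(ℚ))` over `g`),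
  **`Polarization.infinite_center_lefschetzGroup_of_isCMField`** (`Z(S(H)(ℚ))` is infinite).
-/

noncomputable section

open NumberField

namespace Literature.AlgebraicGeometry.Motives

namespace HodgeStructure

universe u

variable {V : Type u} [AddCommGroup V] [Module ℚ V] [Module.Finite ℚ V] {n : ℤ} {H : HodgeStructure V n}

/-! ## §1 Milne's `S₀(A)(ℚ) = {γ ∈ C₀ | γ†γ = 1}` is the centre of `S(A)(ℚ)` -/

/-- **EVERY `z ∈ Z(E_φ)` WITH `z† z = 1` IS A CENTRAL ELEMENT OF `S(H)(ℚ)`**: `z` is invertible (`z† z = 1` in the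
finite-dimensional `End_ℚ(V)`), lies in `C(H)` (it commutes with `E_φ`) and preserves `ψ`, so it is an element of
`S(H)(ℚ)`; it is central because it lies in `E_φ` (g54-#4 `Polarization.mem_center_lefschetzGroup_iff`).  The surjectivity
half of «`S₀(A) → S(A)` is an isomorphism onto the centre». [cite: Milne1999LefschetzClasses, §1 p. 645 L8–L14 (S₀, Prop. 1.7)] -/
theorem Polarization.exists_mem_center_lefschetzGroup_coe_eq (ψ : Polarization H) {z : H.endAlg}
    (hz : z ∈ Subalgebra.center ℚ H.endAlg) (hunit : ψ.adjoint (z : Module.End ℚ V) * (z : Module.End ℚ V) = 1) :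
    ∃ γ : ψ.lefschetzGroup, γ ∈ Subgroup.center ψ.lefschetzGroup ∧
      ((γ : V ≃ₗ[ℚ] V) : Module.End ℚ V) = (z : Module.End ℚ V) := by
  have h12 : (z : Module.End ℚ V) * ψ.adjoint (z : Module.End ℚ V) = 1 := mul_eq_one_symm hunit
  have hzU : IsUnit (z : Module.End ℚ V) := ⟨⟨_, _, h12, hunit⟩, rfl⟩
  set γ₀ : V ≃ₗ[ℚ] V := LinearMap.GeneralLinearGroup.generalLinearEquiv ℚ V hzU.unit with hγ₀def
  have hγ₀ : (γ₀ : Module.End ℚ V) = z := by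
    rw [hγ₀def, LinearMap.GeneralLinearGroup.generalLinearEquiv_to_linearMap, IsUnit.unit_spec]
  have hzC : (z : Module.End ℚ V) ∈ Subalgebra.centralizer ℚ (H.endAlg : Set (Module.End ℚ V)) :=
    (mem_center_endAlg_iff_coe_mem_centralizer_endAlg H z).1 hz
  have hγ₀S : γ₀ ∈ ψ.lefschetzGroup := by
    rw [ψ.mem_lefschetzGroup_iff_adjoint_mul_self_eq_one, hγ₀]
    exact ⟨hzC, hunit⟩
  refine ⟨⟨γ₀, hγ₀S⟩, (ψ.mem_center_lefschetzGroup_iff _).2 ?_, hγ₀⟩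
  change (γ₀ : Module.End ℚ V) ∈ H.endAlg
  rw [hγ₀]
  exact z.2

/-- **`Z(S(H)(ℚ)) ≅ S₀(ℚ) = {z ∈ C₀ | z† z = 1}`**: `γ ↦ ↑γ` is a bijection from the centre of `S(H)(ℚ)` onto the set of
`ℚ`-endomorphisms lying in `Z(E_φ)` with `a† a = 1` (Milne's `S₀(A)(ℚ)`; into: g54-#4 and `γ†γ = 1`; onto: §1 above).
[cite: Milne1999LefschetzClasses, §1 p. 645 L8–L14 (S₀, Prop. 1.7)] [cite: MoonenZarhin1998WeilClasses, §1 Lemma (1)] -/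
theorem Polarization.bijOn_coe_center_lefschetzGroup (ψ : Polarization H) :
    Set.BijOn (fun γ : ψ.lefschetzGroup => ((γ : V ≃ₗ[ℚ] V) : Module.End ℚ V))
      (Subgroup.center ψ.lefschetzGroup : Set ψ.lefschetzGroup)
      {a : Module.End ℚ V | (∃ z : H.endAlg, z ∈ Subalgebra.center ℚ H.endAlg ∧ (z : Module.End ℚ V) = a) ∧
        ψ.adjoint a * a = 1} := by
  refine ⟨?_, ?_, ?_⟩
  · intro γ hγ
    obtain ⟨z, hz, hzγ⟩ := (ψ.mem_center_lefschetzGroup_iff_exists_mem_center γ).1 hγ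
    exact ⟨⟨z, hz, hzγ⟩, ((ψ.mem_lefschetzGroup_iff_adjoint_mul_self_eq_one _).1 γ.2).2⟩
  · intro γ _ γ' _ h
    exact Subtype.ext (LinearEquiv.toLinearMap_injective h)
  · intro a ha
    obtain ⟨⟨z, hz, rfl⟩, hunit⟩ := ha
    obtain ⟨γ, hγ, hγz⟩ := ψ.exists_mem_center_lefschetzGroup_coe_eq hz hunit
    exact ⟨γ, hγ, hγz⟩

/-! ## §2 First kind (types I–III): `Z(S(H)(ℚ))` is finite of order `2^t` -/

omit [Module.Finite ℚ V] in
/-- In a commutative ring which is a field, `y² = 1 ⟹ y = ±1`. [folklore] -/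
private theorem eq_one_or_eq_neg_one_of_mul_self_eq_one₅₄ {R : Type*} [CommRing R] (hR : IsField R) {y : R}
    (hy : y * y = 1) : y = 1 ∨ y = -1 := by
  by_cases h : y - 1 = 0
  · exact Or.inl (sub_eq_zero.1 h)
  · obtain ⟨w, hw⟩ := hR.mul_inv_cancel h
    refine Or.inr (eq_neg_of_add_eq_zero_left ?_)
    calc y + 1 = (y - 1) * w * (y + 1) := by rw [hw, one_mul]
      _ = w * ((y - 1) * (y + 1)) := by ring
      _ = 0 := by rw [show (y - 1) * (y + 1) = 0 by linear_combination hy, mul_zero]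

omit [Module.Finite ℚ V] in
/-- `1 ≠ -1` in the centre of the endomorphism algebra of a Hodge structure with `E_φ ≠ 0` (characteristic `0`). [folklore] -/
private theorem one_ne_neg_one_subringCenter₅₄ {W : Type u} [AddCommGroup W] [Module ℚ W] (H' : HodgeStructure W n)
    [Nontrivial H'.endAlg] : (1 : Subring.center H'.endAlg) ≠ -1 := by
  intro h
  haveI := charZero_endAlg_of_nontrivial H'
  have h' := congrArg (fun x : Subring.center H'.endAlg => (x : H'.endAlg)) h
  simp only [Subring.coe_one, Subring.coe_neg] at h'
  have h2 : (1 : H'.endAlg) + 1 = 0 := by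
    nth_rewrite 2 [h']
    exact add_neg_cancel 1
  have h3 : ((2 : ℕ) : H'.endAlg) = ((0 : ℕ) : H'.endAlg) := by
    rw [Nat.cast_two, Nat.cast_zero, ← one_add_one_eq_two]
    exact h2
  exact two_ne_zero (Nat.cast_injective h3)

/-- The count, in the abstract: if `Z(E_φ) ≃+* Π_{k : ι} R_k` with every `R_k` a field in which `1 ≠ -1`, and `†` is trivial on
`Z(E_φ)`, then `Z(S(H)(ℚ))` is finite of order `2^{#ι}` — a central `γ` is `↑z`, `z ∈ Z(E_φ)`, `z² = 1` (g54-#5), so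
`ζ z` is a sign vector `(±1)_k`, and every sign vector is `ζ` of a `†`-fixed central `z` with `z† z = z² = 1`, which comes
from a central `γ` (§1). [cite: Milne1999LefschetzClasses, §1 p. 645 L1–L14 and §2 Summary p. 652]
[cite: MoonenZarhin1998WeilClasses, §1 Lemma (1)] -/
private theorem Polarization.finite_center_and_natCard_eq₅₄ (ψ : Polarization H) {ι : Type*} [Fintype ι]
    {R : ι → Type*} [∀ k, CommRing (R k)] (ζ : Subring.center H.endAlg ≃+* Π k, R k)
    (hR : ∀ k, IsField (R k)) (hne : ∀ k, (1 : R k) ≠ -1)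
    (hfix : ∀ z : H.endAlg, z ∈ Subalgebra.center ℚ H.endAlg → ψ.adjoint (z : Module.End ℚ V) = z) :
    Finite (Subgroup.center ψ.lefschetzGroup) ∧ Nat.card (Subgroup.center ψ.lefschetzGroup) = 2 ^ Fintype.card ι := by
  classical
  have hsq : ∀ (k : ι) {y : R k}, y * y = 1 → y = 1 ∨ y = -1 := fun k {y} hy =>
    eq_one_or_eq_neg_one_of_mul_self_eq_one₅₄ (hR k) hy
  -- (A) a central `γ` is `↑z_γ` with `z_γ ∈ Z(E_φ)`, `z_γ² = 1`; `γ ↦` the sign vector of `ζ z_γ` is injective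
  have hz : ∀ γ : Subgroup.center ψ.lefschetzGroup, ∃ z : Subring.center H.endAlg,
      ((z : H.endAlg) : Module.End ℚ V) = (((γ : ψ.lefschetzGroup) : V ≃ₗ[ℚ] V) : Module.End ℚ V) ∧ z * z = 1 := by
    intro γ
    obtain ⟨z, hzc, hzγ⟩ := (ψ.mem_center_lefschetzGroup_iff_exists_mem_center (γ : ψ.lefschetzGroup)).1 γ.2
    refine ⟨⟨z, Subring.mem_center_iff.2 (Subalgebra.mem_center_iff.1 hzc)⟩, hzγ, Subtype.ext (Subtype.ext ?_)⟩
    show ((z * z : H.endAlg) : Module.End ℚ V) = ((1 : H.endAlg) : Module.End ℚ V)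
    rw [Subalgebra.coe_mul, Subalgebra.coe_one, hzγ]
    exact ψ.coe_mul_coe_eq_one_of_mem_center_lefschetzGroup hfix γ.2
  choose z hzγ hzz using hz
  have hζsq : ∀ γ k, ζ (z γ) k * ζ (z γ) k = 1 := fun γ k => by
    rw [← Pi.mul_apply, ← ζ.map_mul, hzz, ζ.map_one, Pi.one_apply]
  have hf : Function.Injective
      (fun γ : Subgroup.center ψ.lefschetzGroup => fun k : ι => decide (ζ (z γ) k = 1)) := by
    intro γ γ' h
    have hζ : ζ (z γ) = ζ (z γ') := by
      funext k
      have hk : (ζ (z γ) k = 1 ↔ ζ (z γ') k = 1) := decide_eq_decide.1 (congr_fun h k)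
      rcases hsq k (hζsq γ k) with h1 | h1 <;> rcases hsq k (hζsq γ' k) with h2 | h2
      · rw [h1, h2]
      · rw [h1, hk.1 h1]
      · rw [hk.2 h2, h2]
      · rw [h1, h2]
    apply Subtype.ext
    apply Subtype.ext
    apply LinearEquiv.toLinearMap_injective
    rw [← hzγ γ, ← hzγ γ', ζ.injective hζ]
  haveI hfin : Finite (Subgroup.center ψ.lefschetzGroup) := Finite.of_injective _ hf
  -- (B) every sign vector `(±1)_k` is `ζ` of a `†`-fixed central `w` with `w† w = w² = 1`, hence comes from a central `γ`
  have hg : ∀ s : ι → Bool, ∃ (γ : Subgroup.center ψ.lefschetzGroup) (w : Subring.center H.endAlg),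
      (ζ w = fun k => bif s k then 1 else -1) ∧
        (((γ : ψ.lefschetzGroup) : V ≃ₗ[ℚ] V) : Module.End ℚ V) = ((w : H.endAlg) : Module.End ℚ V) := by
    intro s
    obtain ⟨w, hw⟩ : ∃ w : Subring.center H.endAlg, ζ w = fun k => bif s k then 1 else -1 :=
      ⟨ζ.symm _, ζ.apply_symm_apply _⟩
    have hww : w * w = 1 := by
      apply ζ.injective
      rw [ζ.map_mul, ζ.map_one, hw]
      funext k
      rw [Pi.mul_apply, Pi.one_apply]
      cases s k <;> simp
    have hwc : (w : H.endAlg) ∈ Subalgebra.center ℚ H.endAlg :=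
      Subalgebra.mem_center_iff.2 (Subring.mem_center_iff.1 w.2)
    have hunit : ψ.adjoint ((w : H.endAlg) : Module.End ℚ V) * ((w : H.endAlg) : Module.End ℚ V) = 1 := by
      rw [hfix _ hwc, ← Subalgebra.coe_mul, ← Subring.coe_mul, hww, OneMemClass.coe_one, OneMemClass.coe_one]
    obtain ⟨γ, hγ, hγw⟩ := ψ.exists_mem_center_lefschetzGroup_coe_eq hwc hunit
    exact ⟨⟨γ, hγ⟩, w, hw, hγw⟩
  choose g w hw hg using hg
  have hginj : Function.Injective g := by
    intro s s' h
    have h1 : w s = w s' := by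
      apply Subtype.ext
      apply Subtype.ext
      rw [← hg s, ← hg s', h]
    have h2 := (hw s).symm.trans ((congrArg ζ h1).trans (hw s'))
    funext k
    have hk : (bif s k then (1 : R k) else -1) = bif s' k then 1 else -1 := congr_fun h2 k
    revert hk
    cases s k <;> cases s' k <;> intro hk
    · rfl
    · exact absurd hk (hne k).symm
    · exact absurd hk (hne k)
    · rfl
  refine ⟨hfin, le_antisymm ?_ ?_⟩
  · calc Nat.card (Subgroup.center ψ.lefschetzGroup) ≤ Nat.card (ι → Bool) := Nat.card_le_card_of_injective _ hf
      _ = 2 ^ Fintype.card ι := by rw [Nat.card_eq_fintype_card, Fintype.card_fun, Fintype.card_bool]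
  · calc 2 ^ Fintype.card ι = Nat.card (ι → Bool) := by
          rw [Nat.card_eq_fintype_card, Fintype.card_fun, Fintype.card_bool]
      _ ≤ Nat.card (Subgroup.center ψ.lefschetzGroup) := Nat.card_le_card_of_injective g hginj

/-- **`C₀ ≅ K₁ × ⋯ × K_t` (FIELDS) AND `†` TRIVIAL ON `C₀` ⟹ `#Z(S(A)(ℚ)) = 2^t`**: the centre of `S(H)(ℚ)` is
`{z ∈ C₀ | z² = 1} ≅ μ₂(ℚ)^t` («`C₀(A)` is a product of fields»; `1 ≠ -1` in each `K_k` because `2` is a unit of the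
`ℚ`-algebra `C₀`). [cite: Milne1999LefschetzClasses, §1 p. 645 L1–L14 and §2 Summary p. 652]
[cite: MoonenZarhin1998WeilClasses, §1 Lemma (1)] [cite: Lange2023AbelianVarietiesComplex, §2.6.2 Lemma 2.6.4] -/
theorem Polarization.natCard_center_lefschetzGroup_eq_two_pow_of_ringEquiv_pi (ψ : Polarization H) {ι : Type*}
    [Fintype ι] {F : ι → Type*} [∀ k, Field (F k)] (ζ : Subring.center H.endAlg ≃+* Π k, F k)
    (hfix : ∀ z : H.endAlg, z ∈ Subalgebra.center ℚ H.endAlg → ψ.adjoint (z : Module.End ℚ V) = z) :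
    Nat.card (Subgroup.center ψ.lefschetzGroup) = 2 ^ Fintype.card ι := by
  -- `2` is a unit of `Z(E_φ)` (the scalars `ℚ` are central), hence of every factor `F k`, so `1 ≠ -1` there
  have hφ : ∀ q : ℚ, algebraMap ℚ H.endAlg q ∈ Subring.center H.endAlg := fun q =>
    Subring.mem_center_iff.2 fun b => (Algebra.commutes q b).symm
  have h2 : IsUnit (2 : Subring.center H.endAlg) := by
    rw [← map_ofNat ((algebraMap ℚ H.endAlg).codRestrict _ hφ) 2]
    exact (isUnit_iff_ne_zero.2 two_ne_zero).map _
  have hne : ∀ k, (1 : F k) ≠ -1 := by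
    intro k h
    have h3 : IsUnit (2 : F k) := by
      have h4 := (h2.map ζ).map (Pi.evalRingHom F k)
      rwa [map_ofNat, Pi.evalRingHom_apply, Pi.ofNat_apply] at h4
    have h5 : (2 : F k) = 0 := by
      rw [← one_add_one_eq_two]
      nth_rewrite 2 [h]
      exact add_neg_cancel 1
    rw [h5, isUnit_zero_iff] at h3
    exact zero_ne_one h3
  exact (ψ.finite_center_and_natCard_eq₅₄ ζ (fun k => Field.toIsField (F k)) hne hfix).2

/-- **`†` OF THE FIRST KIND ⟹ `Z(S(A)(ℚ))` IS FINITE** (types I–III: `S(A)` is semisimple — «Semisimple: Yes» in Milne's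
Summary; «in all other cases it is finite»): if the Rosati involution is trivial on the centre `Z(E_φ) = C₀`, the centre of
`S(H)(ℚ)` is a finite group (the tree's `Polarization.exists_isInternal_ringEquiv_subringCenter_pi`: `C₀ ≅` a finite product
of fields). [cite: Milne1999LefschetzClasses, §1 p. 645 L1–L14 and §2 Summary p. 652]
[cite: MoonenZarhin1998WeilClasses, §1 Lemma (1)] [cite: Lange2023AbelianVarietiesComplex, §2.6.2 Lemma 2.6.4] -/
theorem Polarization.finite_center_lefschetzGroup_of_forall_adjoint_eq_self (ψ : Polarization H)
    (hfix : ∀ z : H.endAlg, z ∈ Subalgebra.center ℚ H.endAlg → ψ.adjoint (z : Module.End ℚ V) = z) :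
    Finite (Subgroup.center ψ.lefschetzGroup) := by
  obtain ⟨ι, _, _, W, -, hs, hfield, ζ, -⟩ := ψ.exists_isInternal_ringEquiv_subringCenter_pi
  exact (ψ.finite_center_and_natCard_eq₅₄ ζ hfield
    (fun k => by haveI := hs k; exact one_ne_neg_one_subringCenter₅₄ _) hfix).1

/-- **`†` OF THE FIRST KIND ⟹ `#Z(S(A)(ℚ)) = 2^t`, `t` = THE NUMBER OF SIMPLE FACTORS OF `End⁰`** (= canonical blocks =
isotypic components = minimal non-zero `E_φ`-stable sub-Hodge structures, the tree's `natCard_minimal_stable_eq_card`):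
`Z(S(H)(ℚ)) = {z ∈ C₀ | z² = 1} ≅ μ₂(ℚ)^t` along `C₀ ≅ Π_{k ≤ t} Z(E_φ(W_k))` over the isotypic components (types I–III,
`†` trivial on each totally real factor). [cite: Milne1999LefschetzClasses, §1 p. 645 L1–L14 and §2 Summary p. 652]
[cite: MoonenZarhin1998WeilClasses, §1 Lemma (1)] [cite: Lange2023AbelianVarietiesComplex, §2.4.4 Cor. 2.4.26 and §2.6.2 Lemma 2.6.4] -/
theorem Polarization.natCard_center_lefschetzGroup_eq_two_pow (ψ : Polarization H)
    (hfix : ∀ z : H.endAlg, z ∈ Subalgebra.center ℚ H.endAlg → ψ.adjoint (z : Module.End ℚ V) = z) :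
    Nat.card (Subgroup.center ψ.lefschetzGroup) =
      2 ^ Nat.card {S : SubHodgeStructure H // (∀ a ∈ H.endAlg, ∀ v ∈ S.toSubmodule, a v ∈ S.toSubmodule) ∧
        S.toSubmodule ≠ ⊥ ∧ ∀ S' : SubHodgeStructure H, (∀ a ∈ H.endAlg, ∀ v ∈ S'.toSubmodule, a v ∈ S'.toSubmodule) →
          S'.toSubmodule ≤ S.toSubmodule → S'.toSubmodule = ⊥ ∨ S'.toSubmodule = S.toSubmodule} := by
  classical
  obtain ⟨s, _, κ, c, hT, hirr, hc, hκ⟩ := exists_isInternal_isIrreducible_labelling H ⟨ψ⟩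
  have hirr' : ∀ x : s, (x : SubHodgeStructure H).toHodgeStructure.IsIrreducible := fun x => hirr x x.2
  obtain ⟨e, -⟩ := exists_algEquiv_pi_endAlg_iSup'_fiber (fun S : s => (S : SubHodgeStructure H)) hT hc hκ hirr'
  obtain ⟨ζ, -⟩ := exists_ringEquiv_subringCenter_pi
    (fun k : κ => SubHodgeStructure.iSup' fun x : {i // c i = k} => ((x.1 : s) : SubHodgeStructure H)) e
  have hs : ∀ k : κ, IsSimpleRing
      (SubHodgeStructure.iSup' fun x : {i // c i = k} => ((x.1 : s) : SubHodgeStructure H)).toHodgeStructure.endAlg :=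
    fun k => isSimpleRing_endAlg_iSup'_fiber (fun S : s => (S : SubHodgeStructure H)) hT hc hκ hirr' k
  rw [natCard_minimal_stable_eq_card (fun S : s => (S : SubHodgeStructure H)) hT hc hκ hirr']
  exact (ψ.finite_center_and_natCard_eq₅₄ ζ (fun k => isField_subringCenter_endAlg_of_isSimpleRing _ (hs k))
    (fun k => by haveI := hs k; exact one_ne_neg_one_subringCenter₅₄ _) hfix).2

/-! ## §3 A CM centre (type IV, isotypic): `Z(S(H)(ℚ)) ≅ U_K(ℚ)` is infinite -/

section CentreField

variable {K : Type*} [Field K] [NumberField K] [IsCMField K]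

/-- **TYPE IV: `U_K(ℚ) ≃* Z(S(A)(ℚ))`** — for a CM centre `K ≅ Z(E_φ)` (chart `g`; `†` = complex conjugation on `K`, the
tree's `Polarization.adjointEndAlg_ringEquiv_eq_complexConj`) the map `x ↦` (the central element with underlying
endomorphism `g x`) is a GROUP ISOMORPHISM from Mathlib's unitary group `unitary K = {x | x x̄ = 1}` onto the centre of
`S(H)(ℚ)` (g54-#5: central elements ↔ norm-one elements; §1: each occurs exactly once) — Milne's `S₀(A) = U_{C₀}` for
type IV, Moonen–Zarhin's «the center […] is the group `U_{K_B}`». [cite: Milne1999LefschetzClasses, §1 p. 645 L1–L14 and §2 Summary p. 652 (IV: `GL`, not semisimple)]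
[cite: MoonenZarhin1998WeilClasses, §1 Lemma (1)] [cite: Lange2023AbelianVarietiesComplex, §2.6.2 Lemma 2.6.6] -/
theorem Polarization.exists_unitary_mulEquiv_center_lefschetzGroup (ψ : Polarization H)
    (g : K ≃+* Subring.center H.endAlg) :
    ∃ e : unitary K ≃* Subgroup.center ψ.lefschetzGroup, ∀ x : unitary K,
      ((((e x : Subgroup.center ψ.lefschetzGroup) : ψ.lefschetzGroup) : V ≃ₗ[ℚ] V) : Module.End ℚ V) =
        (((g (x : K) : Subring.center H.endAlg) : H.endAlg) : Module.End ℚ V) := by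
  have hex : ∀ x : unitary K, ∃ γ : Subgroup.center ψ.lefschetzGroup,
      (((γ : ψ.lefschetzGroup) : V ≃ₗ[ℚ] V) : Module.End ℚ V) =
        (((g (x : K) : Subring.center H.endAlg) : H.endAlg) : Module.End ℚ V) := by
    intro x
    obtain ⟨γ, hγ, hγx⟩ := ψ.exists_mem_center_lefschetzGroup_coe_eq_of_mul_complexConj_eq_one g
      ((Literature.NumberTheory.NumberFields.IsCMField.mem_unitary_iff K (x : K)).1 x.2)
    exact ⟨⟨γ, hγ⟩, hγx⟩
  choose f hf using hex
  have hmul : ∀ x y : unitary K, f (x * y) = f x * f y := by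
    intro x y
    apply Subtype.ext
    apply Subtype.ext
    apply LinearEquiv.toLinearMap_injective
    change (((f (x * y) : ψ.lefschetzGroup) : V ≃ₗ[ℚ] V) : Module.End ℚ V) =
      ((((f x : ψ.lefschetzGroup) : V ≃ₗ[ℚ] V) * ((f y : ψ.lefschetzGroup) : V ≃ₗ[ℚ] V) : V ≃ₗ[ℚ] V) : Module.End ℚ V)
    rw [LinearEquiv.coe_toLinearMap_mul, hf, hf, hf, Submonoid.coe_mul, g.map_mul, Subring.coe_mul, Subalgebra.coe_mul]
  have hinj : Function.Injective f := by
    intro x y hxy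
    have h1 : (((g (x : K) : Subring.center H.endAlg) : H.endAlg) : Module.End ℚ V) =
        (((g (y : K) : Subring.center H.endAlg) : H.endAlg) : Module.End ℚ V) := by rw [← hf x, ← hf y, hxy]
    exact Subtype.ext (g.injective (Subtype.ext (Subtype.ext h1)))
  have hsurj : Function.Surjective f := by
    intro γ
    obtain ⟨x, hx, hγx⟩ := (ψ.mem_center_lefschetzGroup_iff_of_isCMField g (γ : ψ.lefschetzGroup)).1 γ.2
    refine ⟨⟨x, (Literature.NumberTheory.NumberFields.IsCMField.mem_unitary_iff K x).2 hx⟩, ?_⟩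
    apply Subtype.ext
    apply Subtype.ext
    apply LinearEquiv.toLinearMap_injective
    rw [hf]
    exact hγx.symm
  exact ⟨MulEquiv.ofBijective (MonoidHom.mk' f hmul) ⟨hinj, hsurj⟩, fun x => hf x⟩

/-- **TYPE IV: `Z(S(A)(ℚ))` IS INFINITE** for a CM centre `K ≅ Z(E_φ)` («Semisimple: No» in Milne's Summary; Moonen–Zarhin:
«a connected torus»): `Z(S(H)(ℚ)) ≅ U_K(ℚ)`, and the unitary group of a CM field has infinitely many rational points (the
tree's `IsCMField.infinite_unitary`, Hilbert 90 `b ↦ b/b̄`). [cite: Milne1999LefschetzClasses, §2 Summary p. 652]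
[cite: MoonenZarhin1998WeilClasses, §1 Lemma (1)] [cite: Lange2023AbelianVarietiesComplex, §2.6.2 Lemma 2.6.6] -/
theorem Polarization.infinite_center_lefschetzGroup_of_isCMField (ψ : Polarization H)
    (g : K ≃+* Subring.center H.endAlg) : Infinite (Subgroup.center ψ.lefschetzGroup) := by
  haveI := Literature.NumberTheory.NumberFields.IsCMField.infinite_unitary K
  obtain ⟨e, -⟩ := ψ.exists_unitary_mulEquiv_center_lefschetzGroup g
  exact Infinite.of_injective e e.injective

end CentreField

end HodgeStructure

end Literature.AlgebraicGeometry.Motives
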